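import Literature.AlgebraicGeometry.Surfaces.PolarisedK3TwinKuranishiFamily
import Literature.AlgebraicGeometry.Surfaces.K3PeriodSurjectivityProofs
import Literature.AlgebraicGeometry.Surfaces.K3TwistorLines

/-!
# Route NikulinTwinTransport · crux `K3PeriodSurjective` (stmt-HodgeConjecture-15154) —
# stub `stub_orbitInvariance` of line `IdeatorOneSketch` (card `ratner-orbit-closure-cm-seed`)

TEMPLATE (lead): exact registered signature; replace `sorry`.
-/

noncomputable section

set_option linter.dupNamespace false

open scoped Matrix Topology
open Literature.AlgebraicGeometry Literature.AlgebraicGeometry.Surfaces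
  Literature.AlgebraicGeometry.HodgeTheory

namespace Summit.HodgeConjecture.HodgeConjecture.Theorems.NikulinTwinTransport

/-- **T3 · orbit invariance** (in-tree lemmas `Huybrechts_K3_periodSurjective_projective.hypotheses_smul`,
`.hypotheses_of_latticeIsometry`, `.conclusion_smul`, `.conclusion_of_latticeIsometry`,
`isUnit_of_k3Isometry`): along `x ↦ t • g x` (`g ∈ O(Λ)`, `t ≠ 0`) projectivity is pushed forward and
realisability is pulled back. -/
theorem stub_orbitInvariance : ∀ (x : K3Index → ℂ) (g : Matrix K3Index K3Index ℤ) (t : ℂ), g.transpose * k3Gram * g = k3Gram → IsUnit g → t ≠ 0 → ((x ∈ k3PeriodDomain ∧ ∃ v : K3Index → ℤ, k3Form (fun i => (v i : ℂ)) x = 0 ∧ 0 < ∑ i, ∑ j, v i * k3Gram i j * v j) → (t • (g.map (Int.cast : ℤ → ℂ) *ᵥ x) ∈ k3PeriodDomain ∧ ∃ v : K3Index → ℤ, k3Form (fun i => (v i : ℂ)) (t • (g.map (Int.cast : ℤ → ℂ) *ᵥ x)) = 0 ∧ 0 < ∑ i, ∑ j, v i * k3Gram i j * v j)) ∧ ((∃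 (S : Motives.SchemeOver ℂ) (_ : IsK3Surface S) (φ : complexBetti S (2 * 1) ≃ₗ[ℂ] (K3Index → ℂ)) (p : complexBetti S (2 * 2)), IsMarkedK3 S φ p (t • (g.map (Int.cast : ℤ → ℂ) *ᵥ x))) → ∃ (S : Motives.SchemeOver ℂ) (_ : IsK3Surface S) (φ : complexBetti S (2 * 1) ≃ₗ[ℂ] (K3Index → ℂ)) (p : complexBetti S (2 * 2)), IsMarkedK3 S φ p x) := by
  intro x g t hg hu ht
  refine ⟨?_, ?_⟩
  · -- push forward the hypotheses along `x ↦ t • g x`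
    rintro ⟨hxD, hv⟩
    rw [mem_k3PeriodDomain_iff] at hxD
    obtain ⟨h1', h2', h3'⟩ :=
      Huybrechts_K3_periodSurjective_projective.hypotheses_of_latticeIsometry hg hxD.1 hxD.2 hv
    obtain ⟨h1, h2, h3⟩ :=
      Huybrechts_K3_periodSurjective_projective.hypotheses_smul ht h1' h2' h3'
    exact ⟨(mem_k3PeriodDomain_iff _).2 ⟨h1, h2⟩, h3⟩
  · -- pull back realisability along `x ↦ t • g x`
    intro hRy
    -- unscale by `t⁻¹`
    have hRg : ∃ (S : Motives.SchemeOver ℂ) (_ : IsK3Surface S)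
        (φ : complexBetti S (2 * 1) ≃ₗ[ℂ] (K3Index → ℂ)) (p : complexBetti S (2 * 2)),
        IsMarkedK3 S φ p (g.map (Int.cast : ℤ → ℂ) *ᵥ x) := by
      have h' := Huybrechts_K3_periodSurjective_projective.conclusion_smul (t := t⁻¹)
        (inv_ne_zero ht) hRy
      rwa [smul_smul, inv_mul_cancel₀ ht, one_smul] at h'
    -- pull back along `g⁻¹ ∈ O(Λ)`
    obtain ⟨u, rfl⟩ := hu
    have hg' : (↑u⁻¹ : Matrix K3Index K3Index ℤ).transpose * k3Gram *
        (↑u⁻¹ : Matrix K3Index K3Index ℤ) = k3Gram := by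
      set gm : Matrix K3Index K3Index ℤ := (u : Matrix K3Index K3Index ℤ) with hgm
      set gi : Matrix K3Index K3Index ℤ := (↑u⁻¹ : Matrix K3Index K3Index ℤ) with hgi
      have hinv : gm * gi = 1 := u.mul_inv
      calc gi.transpose * k3Gram * gi
          = gi.transpose * (gm.transpose * k3Gram * gm) * gi := by rw [hg]
        _ = (gm * gi).transpose * k3Gram * (gm * gi) := by
            rw [Matrix.transpose_mul]
            simp only [Matrix.mul_assoc]
        _ = k3Gram := by rw [hinv, Matrix.transpose_one, Matrix.one_mul, Matrix.mul_one]
    have hR := Huybrechts_K3_periodSurjective_projective.conclusion_of_latticeIsometry hg'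
      (Units.isUnit u⁻¹) hRg
    have hcast : (↑u⁻¹ : Matrix K3Index K3Index ℤ).map (Int.cast : ℤ → ℂ) *
        (↑u : Matrix K3Index K3Index ℤ).map (Int.cast : ℤ → ℂ) = 1 := by
      have h := congrArg (Int.castRingHom ℂ).mapMatrix u.inv_mul
      rw [map_mul, map_one] at h
      simpa only [RingHom.mapMatrix_apply, Int.coe_castRingHom] using h
    rwa [Matrix.mulVec_mulVec, hcast, Matrix.one_mulVec] at hR


end Summit.HodgeConjecture.HodgeConjecture.Theorems.NikulinTwinTransport

end
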